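/-
Copyright (c) 2026 the pub-hodgecm-mathlib formalisation cell (harness21).  Prover seat hodgecm-mathlib-K2E3-p23 (g5), HCML Track B «K2-LIT» ∕ h413
(`stmt-HodgeConjecture-24833`), line `K2_E3_EllipticInputs`, unit U12 «Characters», road «GL-[M6]-sc» (line lead K2E3-p23 (g5), dealer K2E3-plan (g3)),
MEMO «M6sc-BLUEPRINT v4» §1 (ASM): the three coordinates of a class `x̄ ∈ G'` in which the weight `W` is written — height, normalised discriminant, depth.  2026-09-04.
-/
import Summits.HodgeConjecture.HodgeConjecture.Theorems.K2E3GL3ModUniformizerSeparableAE     -- ★ p858176 (K2E3-p14 g5): brings ★ `F0P3cStCharTSHCDGroupToLie` (`continuous_discr_charpoly`, `discr_charpoly_smul_fin_three`)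
import Literature.NumberTheory.Automorphic.LocalFieldHaarBalls                             -- ★ `continuous_normAbs`
import HarnessLib

/-!
# Road «GL-[M6]-sc», ASM brick: THE COORDINATES `(h, δ, L)` OF A CLASS `x̄ ∈ G' = GL₃(F) ⧸ ϖ^ℤ` (Harish-Chandra 1970, VII §3)

Cell `pub/hodgecm-mathlib` (D-0151), Track B «K2-LIT», crux H413 = `stmt-HodgeConjecture-24833`, route of record `HCCMUnconditional`.  Lane
`--supports stmt-HodgeConjecture-24833 --as helper`; THEOREMS ONLY (no `def`, no `instance`, no `notation`, no named-fact hypothesis, no `sorry`); count-neutral.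

★ `K2E3GL3ModUniformizerNonEllBall.ae_setIntegral_norm_conj_le_weight` (`hball`) and ★ `K2E3GL3NonEllWeightLocIntegrable` (`hW`) are written in three user-supplied
coordinates of `x̄ ∈ G'`; this file CONSTRUCTS them (as existential packages — no `def`): §1 a measurable HEIGHT `h : X → ℕ` from any compact exhaustion
(`x ∈ Ω (h x)`, `h ≤ n` on `Ω n`); §2 a measurable DEPTH `L : X → ℕ` from any measurable `δ : X → ℝ≥0` and ratio `0 < r < 1` (`r^{L x} ≤ δ x` when `δ x ≠ 0`,
minimal, `L = 0` where `δ ≥ 1`); §3 the NORMALISED DISCRIMINANT `δ : G' → ℝ≥0`, `δ(mk g) = ‖disc χ_g‖ ∕ ‖det g‖²` — well defined on classes because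
`disc χ_{wg} = w⁶ disc χ_g` (★ `discr_charpoly_smul_fin_three`) and `det (wg) = w³ det g` — and CONTINUOUS (quotient map); §4 the package on `G'` with `r = q⁻¹`.
* §1 `measurable_of_forall_measurableSet_le`, `exists_measurable_height`; §2 `exists_measurable_depth`; §3 `normAbs_discr_div_det_sq_smul`, `exists_continuous_normDisc`;
  §4 **`exists_coordinates`**.
HONEST LABEL: HC_CM is proved only modulo the 7 printed citations (2 remaining named inputs: hLiu418 = stmt-HodgeConjecture-24832, h413 = stmt-HodgeConjecture-24833) until
rung 0 closes; count-neutral helper, closes no socket.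

## References
* [HarishChandra1970] Harish-Chandra (notes by G. van Dijk), *Harmonic Analysis on Reductive p-adic Groups*, LNM 162 (1970), Part VII §3 pp. 72–73 (`D(x)`, `Ω(γ)`).
-/

set_option autoImplicit false
-- the mandated namespace repeats the single-problem summit's segment (`HodgeConjecture.HodgeConjecture`)
set_option linter.dupNamespace false

noncomputable section

open MeasureTheory Measure Set Topology
open scoped MatrixGroups NNReal WithZero
open Literature.NumberTheory.Automorphic Literature.NumberTheory.GaloisRepresentations Literature.NumberTheory.GaloisRepresentations.IsNonarchimedeanLocalField
open Summit.HodgeConjecture.HodgeConjecture.Cruxes.H413.F0P3cStCharTSHCDGroupToLie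

namespace Summit.HodgeConjecture.HodgeConjecture.Cruxes.H413.K2E3GL3ModUniformizerNonEllCoordinates

/-! ## §1 The height attached to a compact exhaustion -/
section Height

variable {X : Type*}

/-- An `ℕ`-valued function with measurable sublevel sets is measurable. [folklore] -/
theorem measurable_of_forall_measurableSet_le [MeasurableSpace X] {f : X → ℕ} (h : ∀ n, MeasurableSet {x | f x ≤ n}) : Measurable f := by
  refine measurable_to_countable' fun n => ?_
  rcases n with _ | n
  · convert h 0 using 1
    ext x; simp
  · have : f ⁻¹' {n + 1} = {x | f x ≤ n + 1} \ {x | f x ≤ n} := by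
      ext x; simp only [mem_preimage, mem_singleton_iff, mem_sdiff, mem_setOf_eq]; omega
    rw [this]; exact (h _).diff (h _)

variable [TopologicalSpace X]

/-- **THE HEIGHT** of a compact exhaustion `Ω`: a measurable `h : X → ℕ` with `x ∈ Ω (h x)` and `h x ≤ n` for `x ∈ Ω n` (the least such index).
[cite: HarishChandra1970, Part VII §3 p. 72] -/
theorem exists_measurable_height [T2Space X] [MeasurableSpace X] [OpensMeasurableSpace X] (Ω : CompactExhaustion X) :
    ∃ hgt : X → ℕ, Measurable hgt ∧ (∀ x, x ∈ Ω (hgt x)) ∧ ∀ (n : ℕ) (x : X), x ∈ Ω n → hgt x ≤ n := by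
  classical
  refine ⟨fun x => Nat.find (Ω.exists_mem x), ?_, fun x => Nat.find_spec (Ω.exists_mem x), fun n x hx => Nat.find_min' _ hx⟩
  refine measurable_of_forall_measurableSet_le fun n => ?_
  have : {x : X | Nat.find (Ω.exists_mem x) ≤ n} = Ω n := by
    ext x
    simp only [mem_setOf_eq, Nat.find_le_iff]
    exact ⟨fun ⟨m, hm, hx⟩ => Ω.subset hm hx, fun hx => ⟨n, le_rfl, hx⟩⟩
  rw [this]; exact (Ω.isClosed n).measurableSet

end Height

/-! ## §2 The depth attached to a measurable `δ ≥ 0` -/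
section Depth

variable {X : Type*} [MeasurableSpace X]

/-- **THE DEPTH**: for measurable `δ : X → ℝ≥0` and `0 < r < 1`, a measurable `L : X → ℕ` with `r^{L x} ≤ δ x` whenever `δ x ≠ 0`, minimal (`δ x < r^{L x − 1}` when
`L x > 0`), and `L x = 0` where `δ x ≥ 1` or `δ x = 0`. [cite: HarishChandra1970, Part VII §3 p. 72] -/
theorem exists_measurable_depth {δ : X → ℝ≥0} (hδ : Measurable δ) {r : ℝ≥0} (hr1 : r < 1) :
    ∃ L : X → ℕ, Measurable L ∧ (∀ x, δ x ≠ 0 → r ^ (L x) ≤ δ x) ∧ (∀ x, 0 < L x → δ x < r ^ (L x - 1)) ∧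
      (∀ x, 1 ≤ δ x → L x = 0) ∧ ∀ x, δ x = 0 → L x = 0 := by
  classical
  have hex : ∀ x, δ x ≠ 0 → ∃ n : ℕ, r ^ n ≤ δ x := fun x hx => by
    obtain ⟨n, hn⟩ := exists_pow_lt_of_lt_one (pos_iff_ne_zero.2 hx) hr1
    exact ⟨n, hn.le⟩
  set L : X → ℕ := fun x => if hx : δ x = 0 then 0 else Nat.find (hex x hx) with hLdef
  have hLle : ∀ x n, δ x ≠ 0 → (L x ≤ n ↔ r ^ n ≤ δ x) := fun x n hx => by
    simp only [hLdef, dif_neg hx, Nat.find_le_iff]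
    exact ⟨fun ⟨m, hm, h⟩ => (pow_le_pow_right_of_le_one' hr1.le hm).trans h, fun h => ⟨n, le_rfl, h⟩⟩
  refine ⟨L, ?_, fun x hx => (hLle x _ hx).1 le_rfl, fun x hL => ?_, fun x h1 => ?_, fun x hx => by simp only [hLdef, dif_pos hx]⟩
  · refine measurable_of_forall_measurableSet_le fun n => ?_
    have : {x | L x ≤ n} = {x | δ x = 0} ∪ {x | r ^ n ≤ δ x} := by
      ext x
      by_cases hx : δ x = 0
      · simp [hLdef, hx]
      · simp only [mem_setOf_eq, mem_union, hx, false_or]; exact hLle x n hx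
    rw [this]
    exact (hδ (measurableSet_singleton 0)).union (hδ measurableSet_Ici)
  · have hx : δ x ≠ 0 := fun h => by simp [hLdef, h] at hL
    by_contra h
    have := (hLle x (L x - 1) hx).2 (not_lt.1 h)
    omega
  · by_cases hx : δ x = 0
    · simp [hLdef, hx]
    · exact Nat.le_zero.1 ((hLle x 0 hx).2 (by simpa using h1))

end Depth

/-! ## §3 The normalised discriminant on `G' = GL₃(F) ⧸ ϖ^ℤ` -/
section NormDisc

variable {F : Type*} [Field F] [ValuativeRel F] [TopologicalSpace F] [IsNonarchimedeanLocalField F]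

/-- `‖disc χ_{w g}‖ ∕ ‖det (w g)‖² = ‖disc χ_g‖ ∕ ‖det g‖²` (`disc` scales by `w⁶`, `det²` by `w⁶`). [cite: HarishChandra1970, Part VII §3 p. 72 (`D(x)`)] -/
theorem normAbs_discr_div_det_sq_smul {w : F} (hw : w ≠ 0) (M : Matrix (Fin 3) (Fin 3) F) :
    normAbs F (w • M).charpoly.discr / normAbs F (w • M).det ^ 2 = normAbs F M.charpoly.discr / normAbs F M.det ^ 2 := by
  rw [discr_charpoly_smul_fin_three, Matrix.det_smul, Fintype.card_fin, map_mul, map_mul, map_pow, map_pow, mul_pow, ← pow_mul]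
  exact mul_div_mul_left _ _ (pow_ne_zero _ ((map_ne_zero _).2 hw))

/-- **THE NORMALISED DISCRIMINANT `δ : G' → ℝ≥0`, `δ(mk g) = ‖disc χ_g‖ ∕ ‖det g‖²`, is well defined and continuous** (the byte shape of the hypothesis `hδ` of ★
`ae_setIntegral_norm_conj_le_weight` and ★ `locallyIntegrable_indicator_not_isCompact_centralizer_rpow_neg`). [cite: HarishChandra1970, Part VII §3 p. 72 (`D(x)`)] -/
theorem exists_continuous_normDisc {ϖ : F} (hϖ0 : ϖ ≠ 0)
    [((Subgroup.zpowers (Units.mk0 ϖ hϖ0)).map (Matrix.GeneralLinearGroup.scalar (Fin 3))).Normal] :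
    ∃ δ : GL (Fin 3) F ⧸ (Subgroup.zpowers (Units.mk0 ϖ hϖ0)).map (Matrix.GeneralLinearGroup.scalar (Fin 3)) → ℝ≥0,
      (∀ g : GL (Fin 3) F, δ (QuotientGroup.mk g) =
          normAbs F ((g : Matrix (Fin 3) (Fin 3) F)).charpoly.discr / normAbs F ((g : Matrix (Fin 3) (Fin 3) F)).det ^ 2) ∧
      Continuous δ := by
  obtain ⟨f, hf⟩ : ∃ f : GL (Fin 3) F → ℝ≥0, ∀ g, f g =
      normAbs F ((g : Matrix (Fin 3) (Fin 3) F)).charpoly.discr / normAbs F ((g : Matrix (Fin 3) (Fin 3) F)).det ^ 2 := ⟨_, fun _ => rfl⟩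
  -- invariance along the fibres of `mk`
  have key : ∀ g n : GL (Fin 3) F, n ∈ (Subgroup.zpowers (Units.mk0 ϖ hϖ0)).map (Matrix.GeneralLinearGroup.scalar (Fin 3)) → f (g * n) = f g := by
    intro g n hn
    obtain ⟨w, -, hw⟩ := Subgroup.mem_map.1 hn
    have hcoe : (((g * n : GL (Fin 3) F)) : Matrix (Fin 3) (Fin 3) F) = (w : F) • (g : Matrix (Fin 3) (Fin 3) F) := by
      rw [← hw, Units.val_mul, Matrix.GeneralLinearGroup.coe_scalar, Matrix.scalar_apply, ← Matrix.smul_eq_mul_diagonal]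
    rw [hf, hf, hcoe]; exact normAbs_discr_div_det_sq_smul w.ne_zero _
  have hmk : ∀ g : GL (Fin 3) F,
      f ((QuotientGroup.mk g : GL (Fin 3) F ⧸ (Subgroup.zpowers (Units.mk0 ϖ hϖ0)).map (Matrix.GeneralLinearGroup.scalar (Fin 3))).out) = f g := fun g => by
    obtain ⟨h, hh⟩ := QuotientGroup.mk_out_eq_mul ((Subgroup.zpowers (Units.mk0 ϖ hϖ0)).map (Matrix.GeneralLinearGroup.scalar (Fin 3))) g
    rw [hh]; exact key g h h.2
  refine ⟨fun x => f x.out, fun g => (hmk g).trans (hf g), ?_⟩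
  -- continuity through the quotient map
  have hfc : Continuous f := by
    have : f = fun g : GL (Fin 3) F =>
        normAbs F ((g : Matrix (Fin 3) (Fin 3) F)).charpoly.discr / normAbs F ((g : Matrix (Fin 3) (Fin 3) F)).det ^ 2 := funext hf
    rw [this]
    refine ((LocalFieldHaar.continuous_normAbs (F := F)).comp ((continuous_discr_charpoly (K := F)).comp Units.continuous_val)).div
      (((LocalFieldHaar.continuous_normAbs (F := F)).comp ((continuous_id.matrix_det).comp Units.continuous_val)).pow 2) fun g => ?_
    exact pow_ne_zero _ ((map_ne_zero _).2 ((Matrix.isUnit_iff_isUnit_det _).1 (Units.isUnit g)).ne_zero)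
  refine (QuotientGroup.isQuotientMap_mk _).continuous_iff.2 ?_
  convert hfc using 1
  funext g
  exact hmk g

end NormDisc

/-! ## §4 The package on `G'` -/

variable {F : Type*} [Field F] [Valued F ℤᵐ⁰] [ValuativeRel F] [(Valued.v : Valuation F ℤᵐ⁰).Compatible] [IsNonarchimedeanLocalField F]
  {ϖ : F} (hϖ : Valued.v ϖ = WithZero.exp (-1 : ℤ)) (hϖ0 : ϖ ≠ 0)
  [((Subgroup.zpowers (Units.mk0 ϖ hϖ0)).map (Matrix.GeneralLinearGroup.scalar (Fin 3))).Normal]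
  [MeasurableSpace (GL (Fin 3) F ⧸ (Subgroup.zpowers (Units.mk0 ϖ hϖ0)).map (Matrix.GeneralLinearGroup.scalar (Fin 3)))]
  [BorelSpace (GL (Fin 3) F ⧸ (Subgroup.zpowers (Units.mk0 ϖ hϖ0)).map (Matrix.GeneralLinearGroup.scalar (Fin 3)))]

include hϖ in
/-- **THE COORDINATES `(h, δ, L)` ON `G'`** for a compact exhaustion `Ω`: measurable height `h` (`x ∈ Ω (h x)`, `h ≤ n` on `Ω n`), continuous normalised discriminant `δ`
(`δ(mk g) = ‖disc χ_g‖ ∕ ‖det g‖²`), measurable depth `L` (`q^{-L x} ≤ δ x` for `δ x ≠ 0`, `δ x < q^{-(L x − 1)}` for `L x > 0`, `L = 0` where `δ ≥ 1` or `δ = 0`).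
[cite: HarishChandra1970, Part VII §3 pp. 72–73] -/
theorem exists_coordinates (Ω : CompactExhaustion (GL (Fin 3) F ⧸ (Subgroup.zpowers (Units.mk0 ϖ hϖ0)).map (Matrix.GeneralLinearGroup.scalar (Fin 3)))) :
    ∃ (hgt : GL (Fin 3) F ⧸ (Subgroup.zpowers (Units.mk0 ϖ hϖ0)).map (Matrix.GeneralLinearGroup.scalar (Fin 3)) → ℕ)
      (δ : GL (Fin 3) F ⧸ (Subgroup.zpowers (Units.mk0 ϖ hϖ0)).map (Matrix.GeneralLinearGroup.scalar (Fin 3)) → ℝ≥0)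
      (L : GL (Fin 3) F ⧸ (Subgroup.zpowers (Units.mk0 ϖ hϖ0)).map (Matrix.GeneralLinearGroup.scalar (Fin 3)) → ℕ),
      Measurable hgt ∧ (∀ x, x ∈ Ω (hgt x)) ∧ (∀ (n : ℕ) x, x ∈ Ω n → hgt x ≤ n) ∧
      Continuous δ ∧ (∀ g : GL (Fin 3) F, δ (QuotientGroup.mk g) =
          normAbs F ((g : Matrix (Fin 3) (Fin 3) F)).charpoly.discr / normAbs F ((g : Matrix (Fin 3) (Fin 3) F)).det ^ 2) ∧
      Measurable L ∧ (∀ x, δ x ≠ 0 → ((residueFieldCard F : ℝ≥0)⁻¹) ^ (L x) ≤ δ x) ∧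
        (∀ x, 0 < L x → δ x < ((residueFieldCard F : ℝ≥0)⁻¹) ^ (L x - 1)) ∧ (∀ x, 1 ≤ δ x → L x = 0) ∧ (∀ x, δ x = 0 → L x = 0) := by
  haveI : T2Space (GL (Fin 3) F ⧸ (Subgroup.zpowers (Units.mk0 ϖ hϖ0)).map (Matrix.GeneralLinearGroup.scalar (Fin 3))) :=
    K2E3GL3ModCocompactCentral.t2Space_quotScalar _ (K2E3GL3ModUniformizerCocompact.isClosed_zpowers_uniformizer hϖ hϖ0)
  obtain ⟨hgt, hm, h1, h2⟩ := exists_measurable_height Ω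
  obtain ⟨δ, hδ, hδc⟩ := exists_continuous_normDisc (F := F) hϖ0
  obtain ⟨L, hLm, hL1, hL2, hL3, hL4⟩ := exists_measurable_depth hδc.measurable (inv_residueFieldCard_lt_one (F := F))
  exact ⟨hgt, δ, L, hm, h1, h2, hδc, hδ, hLm, hL1, hL2, hL3, hL4⟩

end Summit.HodgeConjecture.HodgeConjecture.Cruxes.H413.K2E3GL3ModUniformizerNonEllCoordinates

end
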